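import Literature.Computability.Cryptography.SIS
import Literature.Computability.Cryptography.StatisticalDistanceMixtures
import HarnessLib

/-!
# The average-case `SIS` oracle as a `PMF` kernel: `successProb` read as a probability under the uniform matrix law

Topic `Computability/Cryptography` (family `pqc`). Theorems only. `SIS.successProb B n m q β`
(`SIS.lean`, MR07 Def. 5.3) is the uniform AVERAGE over `A ∈ ℤ_q^{n×m}` of the success probabilities
`B.pr … (encodeMatrix A) {…}` of the randomized solver `B`; the idealised reductions of
Micciancio–Regev 2007 (`Algebra/EuclideanLattices/MRIncGDDIdealised.lean`, Thm. 5.9) take the oracle as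
a KERNEL `O : ℤ_q^{n×m} → PMF ℤᵐ` and measure its success as the mass of an event under the pairing
`A ∼ U(ℤ_q^{n×m}), z ∼ O(A)`. This file identifies the two:

* `SIS.matrixAvg_eq_tsum` — `matrixAvg g = ∑_A U(A) · g A` (the average is the expectation under
  `PMF.uniformOfFintype`);
* `SIS.oracleKernel B` is NOT a new definition: the kernel is written inline as
  `A ↦ (B.outputPMF id (encodeMatrix A)).map (decodeIntVec m)`;
* `SIS.matrixAvg_pr_eq_toReal_bind` — for any family of events `E_A` on decoded outputs,
  `matrixAvg (A ↦ Pr[decode (B(A)) ∈ E_A]) = Pr_{A ∼ U, z ∼ kernel(A)}[z ∈ E_A]`;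
* `SIS.successProb_eq_toReal_bind`, `SIS.successProb'_eq_toReal_bind` — the success probabilities of
  MR07 Def. 5.3/5.4 as such masses.

## References

* D. Micciancio, O. Regev, *Worst-case to average-case reductions based on Gaussian measures*,
  SIAM J. Comput. 37 (2007) 267–302, Def. 5.3–5.4 and the use of the oracle in the proof of Thm. 5.9
  ("on input a uniformly random matrix A, the oracle call F(A) returns … with probability δ").
-/

noncomputable section

open scoped ENNReal

namespace Literature.Computability.Cryptography.SIS

open Literature.Computability.Complexity Literature.Algebra.EuclideanLattices

variable {n m q : ℕ} [NeZero q]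

/-- **The uniform average is the expectation under the uniform law**:
`matrixAvg g = ∑_A U(A) · g A`. [folklore] -/
theorem matrixAvg_eq_tsum (g : Matrix (Fin n) (Fin m) (ZMod q) → ℝ) :
    matrixAvg n m q g =
      ∑' A, (PMF.uniformOfFintype (Matrix (Fin n) (Fin m) (ZMod q)) A).toReal * g A := by
  rw [tsum_fintype, matrixAvg, Finset.sum_div]
  refine Finset.sum_congr rfl fun A _ => ?_
  rw [PMF.uniformOfFintype_apply, card_matrix, ENNReal.toReal_inv, ENNReal.toReal_natCast,
    div_eq_inv_mul]
  push_cast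
  ring

/-- **`matrixAvg` of solver probabilities is the mass of the paired event.** For any family of
events `E_A ⊆ ℤᵐ` on the decoded outputs,
`matrixAvg (A ↦ Pr[decode_m (B(encodeMatrix A)) ∈ E_A]) = Pr_{A ∼ U, z ∼ (B(A)).map decode}[z ∈ E_A]`.
[cite: MicciancioRegev2007, Def. 5.3 and Thm. 5.9 (proof: the oracle's success probability δ)] -/
theorem matrixAvg_pr_eq_toReal_bind (B : RandAlg (List Bool) (List Bool))
    (E : Matrix (Fin n) (Fin m) (ZMod q) → Set (Fin m → ℤ)) :
    matrixAvg n m q (fun A => B.pr id (encodeMatrix A) {w | decodeIntVec m w ∈ E A}) =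
      (((PMF.uniformOfFintype (Matrix (Fin n) (Fin m) (ZMod q))).bind fun A =>
          ((B.outputPMF id (encodeMatrix A)).map (decodeIntVec m)).map (Prod.mk A)).toOuterMeasure
        {az | az.2 ∈ E az.1}).toReal := by
  rw [matrixAvg_eq_tsum, PMF.toReal_toOuterMeasure_bind_apply]
  refine tsum_congr fun A => ?_
  congr 1
  rw [RandAlg.pr, PMF.toOuterMeasure_map_apply, PMF.toOuterMeasure_map_apply]
  rfl

/-- **MR07 Def. 5.3's success probability as a mass**: `SIS.successProb B n m q β =
Pr_{A ∼ U, z ∼ (B(A)).map decode}[IsSolution A β z]`. [cite: MicciancioRegev2007, Def. 5.3] -/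
theorem successProb_eq_toReal_bind (B : RandAlg (List Bool) (List Bool)) (β : ℝ) :
    successProb B n m q β =
      (((PMF.uniformOfFintype (Matrix (Fin n) (Fin m) (ZMod q))).bind fun A =>
          ((B.outputPMF id (encodeMatrix A)).map (decodeIntVec m)).map (Prod.mk A)).toOuterMeasure
        {az | IsSolution az.1 β az.2}).toReal :=
  matrixAvg_pr_eq_toReal_bind B fun A => {z | IsSolution A β z}

/-- **MR07 Def. 5.4's success probability (SIS′) as a mass.** [cite: MicciancioRegev2007, Def. 5.4] -/
theorem successProb'_eq_toReal_bind (B : RandAlg (List Bool) (List Bool)) (β : ℝ) :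
    successProb' B n m q β =
      (((PMF.uniformOfFintype (Matrix (Fin n) (Fin m) (ZMod q))).bind fun A =>
          ((B.outputPMF id (encodeMatrix A)).map (decodeIntVec m)).map (Prod.mk A)).toOuterMeasure
        {az | IsSolution' az.1 β az.2}).toReal :=
  matrixAvg_pr_eq_toReal_bind B fun A => {z | IsSolution' A β z}

omit [NeZero q] in
/-- **The event of the idealised analysis contains the SIS-success-with-guess event**: if
`IsSolution A β z` and `z_{j₀} = a` then `A z ≡ 0`, `∑ zᵢ² ≤ β²` and `z_{j₀} = a` (the form of the
event `H₀` in `MRIncGDDIdealised.toReal_experiment_success_ge`). [cite: MicciancioRegev2007, Thm. 5.9 (proof, event H, eq. (12))] -/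
theorem mulVec_eq_zero_and_of_isSolution {A : Matrix (Fin n) (Fin m) (ZMod q)} {β : ℝ}
    {z : Fin m → ℤ} (h : IsSolution A β z) {j₀ : Fin m} {a : ℤ} (hj : z j₀ = a) :
    A.mulVec (fun i => (z i : ZMod q)) = 0 ∧ ∑ i, (z i : ℝ) ^ 2 ≤ β ^ 2 ∧ z j₀ = a := by
  refine ⟨h.2.1, ?_, hj⟩
  have hβ : 0 ≤ β := (norm_nonneg _).trans h.2.2
  have hn := h.2.2
  rw [norm_intVecToEuclidean] at hn
  have hs : 0 ≤ ∑ j, (z j : ℝ) ^ 2 := Finset.sum_nonneg fun j _ => sq_nonneg _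
  calc ∑ i, (z i : ℝ) ^ 2 = (Real.sqrt (∑ i, (z i : ℝ) ^ 2)) ^ 2 := (Real.sq_sqrt hs).symm
    _ ≤ β ^ 2 := by gcongr

end Literature.Computability.Cryptography.SIS

end
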